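import Literature.Geometry.ComplexAnalytic.RelativeExponentialChartEtaleOfMFDeriv    -- ★ p848606 `exists_localInverse_of_bijective_mfderiv`
import Mathlib.Algebra.Module.ZLattice.Basic
import Mathlib.LinearAlgebra.Complex.FiniteDimensional
import HarnessLib

/-!
# (L1) KERNEL LATTICE of a relative exponential FLOW datum with compact fibres
# ([BirkenhakeLange2004] §1.1 Lemma 1.1.2–1.1.3; [MumfordAV1970] §1 (1)–(2); [DeligneHodgeII1971] §4.4 (4.4.2))

Layer `Literature/Geometry/ComplexAnalytic`, namespace `Literature.Geometry.ComplexAnalytic` (helpers in the sub-namespace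
`RelExpFlow`).  THEOREMS ONLY (no definition, no named fact, no instance, no notation, no `sorry`).  Cell `hodgecm-mathlib`
(D-0151), FLOOR 0, P6 «MOD» (crux hLiu418 = stmt-HodgeConjecture-24832, `--supports`), «L8-PREP» letter **(L1)** of LA1-plan (g2)
(`F0/P6/L1/LA1-plan/g2/RelativeExponentialFlowChart.letters.v1.lean` f624b8d3345ff64b :60, token for token), paid by LA7-p02 (g2).
HC_CM is proved only modulo the 7 printed citations (2 remaining: hLiu418 = stmt-HodgeConjecture-24832, h413 = stmt-HodgeConjecture-24833)
until rung 0 closes; this file is generic complex-analytic ∕ linear-algebraic and changes no count.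

THE SETTING is the tree's generic one of ★ `IsRelExpChartOn EB EM p U Φ ex` (`RelativeExponentialChart.lean`): a map of complex manifolds
`p : M → B` (model spaces `EM`, `EB`, finite-dimensional), a complex vector space `E` and a RELATIVE EXPONENTIAL FLOW DATUM on an open
`U ⊆ B`, unbundled: `ex : B × E → M` is `C^ω` on `U × E` (`hex`), lies over `p` (`hp`), has bijective complex differential on `U × E`
(`hbij`), satisfies the TRANSLATION LAW of a fibrewise `E`-action (`hsub : ex (b, z) = ex (b, z') ↔ ex (b, z' - z) = ex (b, 0)`) and is
onto every fibre over `U` (`hsurj`).  In print: the relative exponential `exp : Lie(A∕S)|_U = U × ℂ^g → A^an|_U` of an abelian scheme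
([DeligneHodgeII1971] §4.4 (4.4.2)) before one knows that its fibrewise kernels are lattices.

* §1 `RelExpFlow.span_eq_top_of_isOpenMap` — the COCOMPACTNESS ENGINE (pure topology ∕ linear algebra): if `ψ : E → X` is a continuous OPEN
  surjection onto a COMPACT space whose fibres are cosets of the subgroup `K` (`ψ z = ψ z' → z' - z ∈ K`), then `K` spans `E` over `ℝ`
  (otherwise a nonzero real linear form vanishing on `K` descends through the quotient map `ψ` to a continuous map of the compact `X` ONTO
  `ℝ`) — the argument of ★ `Kaehler.TorusOfExp.span_intKer_eq_top`, freed from the group structure on the target.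
* §1 `RelExpFlow.exists_frame_of_isZLattice` — the FRAME ENGINE: a discrete `ℤ`-submodule spanning `E` is `Φ₀ (ℤ^ι)` for a real frame
  `Φ₀ : (ι → ℝ) ≃L[ℝ] E` on ANY index type with `card ι = 2 · dim_ℂ E` (Mathlib `ZLattice`: a `ℤ`-basis, REINDEXED along
  `Fintype.equivOfCardEq`, is an `ℝ`-basis — `Module.Basis.ofZLatticeBasis`) — ★ `TorusOfExp.exists_frame` with the index type prescribed.
* §2 `RelExpFlow.isOpen_image_prod` ∕ `exists_nhds_injOn` — for a flow datum, `ex '' (U × W)` is open for `W` open (local inverses, ★ p848606)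
  and `ex (b, ·)` is injective near `0`.
* §3 **`exists_frame_kernel_of_relExpFlow`** = (L1): for `b ∈ U` with COMPACT fibre `p⁻¹ b` the stabiliser `{w | ex (b, w) = ex (b, 0)}` is
  `Φ₀ (ℤ^ι)` for a real frame `Φ₀ : (ι → ℝ) ≃L[ℝ] E`, whenever `card ι = 2 · dim_ℂ E`.

Junk guard: (L1) is FALSE without the compact fibre (`𝔾_m`-type families: kernel of rank 1) — `hcpt` is load-bearing (§1 engine).
[BirkenhakeLange2004] §1.1: «a lattice `Λ` in `V` is a discrete subgroup of maximal rank … `X = V∕Λ` is compact»; Lemma 1.1.2–1.1.3.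

## References
* [BirkenhakeLange2004] C. Birkenhake, H. Lange, *Complex Abelian Varieties*, 2nd ed. (2004), §1.1 Lemma 1.1.2–1.1.3.
* [MumfordAV1970] D. Mumford, *Abelian Varieties* (1970), §1 (1)–(2).
* [DeligneHodgeII1971] P. Deligne, *Théorie de Hodge II*, Publ. Math. IHÉS 40 (1971), §4.4 (4.4.2) p. 50.
* [FritzscheGrauert2002] K. Fritzsche, H. Grauert, *From Holomorphic Functions to Complex Manifolds* (2002), Ch. I §7 Thm. 7.6.
-/

set_option autoImplicit false

noncomputable section

open scoped Manifold ContDiff Topology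
open Set Function Module Submodule

namespace Literature.Geometry.ComplexAnalytic

namespace RelExpFlow

/-! ### §1 Engines: cocompact ⇒ spanning; discrete + spanning ⇒ a frame on a prescribed index type -/

section Engines

variable {E : Type*} [NormedAddCommGroup E] [NormedSpace ℂ E] [FiniteDimensional ℂ E]

/-- **Cocompactness engine.**  If `ψ : E → X` is a continuous open surjection of the finite-dimensional complex space `E` onto a compact
space `X` whose fibres lie in cosets of the additive subgroup `K` (`ψ z = ψ z' → z' - z ∈ K`), then `K` spans `E` over `ℝ`: otherwise a
nonzero real linear form vanishing on `K` descends through the quotient map `ψ` to a continuous map of the compact `X` onto `ℝ`.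
[cite: BirkenhakeLange2004, §1.1 Lemma 1.1.2 (proof)] -/
theorem span_eq_top_of_isOpenMap {X : Type*} [TopologicalSpace X] [CompactSpace X] (K : AddSubgroup E) (ψ : E → X)
    (hcont : Continuous ψ) (hopen : IsOpenMap ψ) (hsurj : Surjective ψ)
    (hK : ∀ z z' : E, ψ z = ψ z' → z' - z ∈ K) :
    span ℝ (K : Set E) = ⊤ := by
  by_contra hne
  obtain ⟨f, hf0, hle⟩ := Submodule.exists_le_ker_of_lt_top _ (lt_top_iff_ne_top.2 hne)
  set fbar : X → ℝ := fun x ↦ f (surjInv hsurj x) with hfbar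
  have hcomp : fbar ∘ ψ = f := by
    funext v
    simp only [comp_apply, hfbar]
    have hk : v - surjInv hsurj (ψ v) ∈ (K : Set E) := hK _ _ (surjInv_eq hsurj (ψ v))
    have hker : f (v - surjInv hsurj (ψ v)) = 0 := LinearMap.mem_ker.1 (hle (Submodule.subset_span hk))
    rw [map_sub, sub_eq_zero] at hker
    exact hker.symm
  have hq : Topology.IsQuotientMap ψ := hopen.isQuotientMap hcont hsurj
  have hfcont : Continuous f := f.continuous_of_finiteDimensional
  have hfbar_cont : Continuous fbar := hq.continuous_iff.2 (hcomp ▸ hfcont)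
  have hrange : range fbar = univ := by
    apply eq_univ_of_forall
    intro t
    obtain ⟨v, hv⟩ : ∃ v, f v ≠ 0 := by
      by_contra h
      push Not at h
      exact hf0 (LinearMap.ext h)
    refine ⟨ψ ((t / f v) • v), ?_⟩
    have := congrFun hcomp ((t / f v) • v)
    simp only [comp_apply] at this
    rw [this, map_smul, smul_eq_mul, div_mul_cancel₀ _ hv]
  have hc : IsCompact (univ : Set ℝ) := hrange ▸ isCompact_range hfbar_cont
  exact noncompact_univ ℝ hc

/-- **Frame engine on a prescribed index type.**  A discrete `ℤ`-submodule `L` spanning the finite-dimensional complex space `E` over `ℝ`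
(a full `ℤ`-lattice, Mathlib `IsZLattice`) is `Φ₀ (ℤ^ι)` for a real frame `Φ₀ : (ι → ℝ) ≃L[ℝ] E` on ANY finite index type `ι` with
`card ι = 2 · dim_ℂ E`: a `ℤ`-basis of `L`, reindexed by `ι`, is an `ℝ`-basis of `E` (`Module.Basis.ofZLatticeBasis`).
[cite: BirkenhakeLange2004, §1.1 (a lattice is a discrete subgroup of maximal rank `2g`)] -/
theorem exists_frame_of_isZLattice {ι : Type*} [Fintype ι] (L : Submodule ℤ E) [DiscreteTopology L] [IsZLattice ℝ L]
    (hι : Fintype.card ι = 2 * Module.finrank ℂ E) :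
    ∃ Φ₀ : (ι → ℝ) ≃L[ℝ] E, ∀ w : E, w ∈ L ↔ ∃ n : ι → ℤ, w = Φ₀ (fun i => (n i : ℝ)) := by
  classical
  haveI := ZLattice.module_free ℝ L
  haveI := ZLattice.module_finite ℝ L
  let b₀ := Module.Free.chooseBasis ℤ L
  have hcard : Fintype.card (Module.Free.ChooseBasisIndex ℤ L) = Fintype.card ι := by
    rw [← Module.finrank_eq_card_chooseBasisIndex, ZLattice.rank ℝ L, finrank_real_of_complex, hι]
  let e : Module.Free.ChooseBasisIndex ℤ L ≃ ι := Fintype.equivOfCardEq hcard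
  let b : Basis ι ℤ L := b₀.reindex e
  let B : Basis ι ℝ E := b.ofZLatticeBasis ℝ L
  have hB : ∀ i, (B i : E) = b i := fun i ↦ b.ofZLatticeBasis_apply ℝ L i
  refine ⟨B.equivFun.symm.toContinuousLinearEquiv, fun w ↦ ?_⟩
  have hΦ : ∀ x : ι → ℝ, B.equivFun.symm.toContinuousLinearEquiv x = ∑ i, x i • (b i : E) := fun x ↦ by
    change B.equivFun.symm x = _
    rw [Basis.equivFun_symm_apply]
    simp_rw [hB]
  have hint : ∀ n : ι → ℤ, ∑ i, ((n i : ℝ)) • (b i : E) = ((∑ i, n i • b i : L) : E) := fun n ↦ by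
    rw [Submodule.coe_sum]
    refine Finset.sum_congr rfl fun i _ ↦ ?_
    rw [Submodule.coe_smul_of_tower, Int.cast_smul_eq_zsmul]
  constructor
  · intro hw
    refine ⟨fun i ↦ b.repr ⟨w, hw⟩ i, ?_⟩
    rw [hΦ, hint]
    have hsum : (∑ i, b.repr ⟨w, hw⟩ i • b i : L) = ⟨w, hw⟩ := b.sum_repr ⟨w, hw⟩
    rw [hsum]
  · rintro ⟨n, rfl⟩
    rw [hΦ, hint]
    exact Submodule.coe_mem _

end Engines

/-! ### §2 A relative exponential flow datum: open images and local injectivity -/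

section Flow

variable {EB : Type*} [NormedAddCommGroup EB] [NormedSpace ℂ EB] [FiniteDimensional ℂ EB]
  {B : Type*} [TopologicalSpace B] [ChartedSpace EB B]
  {E : Type*} [NormedAddCommGroup E] [NormedSpace ℂ E] [FiniteDimensional ℂ E]
  {EM : Type*} [NormedAddCommGroup EM] [NormedSpace ℂ EM]
  {M : Type*} [TopologicalSpace M] [ChartedSpace EM M]

/-- For a `C^ω` map `ex : B × E → M` with bijective differential on the open `U × E`, the image `ex '' (U × W)` of `U × W`, `W` open,
is open in `M` (`ex` is a local homeomorphism there: ★ `exists_localInverse_of_bijective_mfderiv`).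
[cite: FritzscheGrauert2002, Ch. I §7 Thm. 7.6] -/
theorem isOpen_image_prod [IsManifold 𝓘(ℂ, EB) ω B] [IsManifold 𝓘(ℂ, EM) ω M]
    {U : Set B} {ex : B × E → M} (hU : IsOpen U)
    (hex : ContMDiffOn (𝓘(ℂ, EB).prod 𝓘(ℂ, E)) 𝓘(ℂ, EM) ω ex (U ×ˢ (univ : Set E)))
    (hbij : ∀ q ∈ U ×ˢ (univ : Set E), Bijective (mfderiv (𝓘(ℂ, EB).prod 𝓘(ℂ, E)) 𝓘(ℂ, EM) ex q))
    {W : Set E} (hW : IsOpen W) :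
    IsOpen (ex '' (U ×ˢ W)) := by
  rw [isOpen_iff_forall_mem_open]
  rintro _ ⟨q, hq, rfl⟩
  obtain ⟨e, hqe, -, heq, -⟩ :=
    exists_localInverse_of_bijective_mfderiv (n := ω) (by simp) hU hex hbij q ⟨hq.1, mem_univ _⟩
  refine ⟨e '' (e.source ∩ U ×ˢ W), ?_, ?_, ⟨q, ⟨hqe, hq⟩, heq q hqe⟩⟩
  · rintro _ ⟨y, ⟨hye, hyW⟩, rfl⟩
    exact ⟨y, hyW, (heq y hye).symm⟩
  · exact e.isOpen_image_of_subset_source (e.open_source.inter (hU.prod hW)) inter_subset_left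

/-- For such an `ex` and `b ∈ U`, the fibre map `z ↦ ex (b, z)` is injective on a neighbourhood of any point of `E` (local inverse at
`(b, z₀)`). [cite: FritzscheGrauert2002, Ch. I §7 Thm. 7.6] -/
theorem exists_nhds_injOn [IsManifold 𝓘(ℂ, EB) ω B] [IsManifold 𝓘(ℂ, EM) ω M]
    {U : Set B} {ex : B × E → M} (hU : IsOpen U)
    (hex : ContMDiffOn (𝓘(ℂ, EB).prod 𝓘(ℂ, E)) 𝓘(ℂ, EM) ω ex (U ×ˢ (univ : Set E)))
    (hbij : ∀ q ∈ U ×ˢ (univ : Set E), Bijective (mfderiv (𝓘(ℂ, EB).prod 𝓘(ℂ, E)) 𝓘(ℂ, EM) ex q))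
    {b : B} (hb : b ∈ U) (z₀ : E) :
    ∃ V ∈ 𝓝 z₀, V.InjOn fun z : E ↦ ex (b, z) := by
  obtain ⟨e, hqe, -, heq, -⟩ :=
    exists_localInverse_of_bijective_mfderiv (n := ω) (by simp) hU hex hbij (b, z₀) ⟨hb, mem_univ _⟩
  have hcont : Continuous fun z : E ↦ ((b, z) : B × E) := continuous_const.prodMk continuous_id
  refine ⟨(fun z : E ↦ ((b, z) : B × E)) ⁻¹' e.source, (e.open_source.preimage hcont).mem_nhds hqe, ?_⟩
  intro z hz z' hz' hzz'
  have h : e (b, z) = e (b, z') := by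
    rw [heq _ hz, heq _ hz']
    exact hzz'
  exact (Prod.ext_iff.1 (e.injOn hz hz' h)).2

end Flow

end RelExpFlow

/-! ### §3 (L1): the stabiliser of a flow datum over a compact fibre is a full lattice -/

section KernelLattice

variable {EB : Type*} [NormedAddCommGroup EB] [NormedSpace ℂ EB] [FiniteDimensional ℂ EB]
  {B : Type*} [TopologicalSpace B] [ChartedSpace EB B]
  {E : Type*} [NormedAddCommGroup E] [NormedSpace ℂ E] [FiniteDimensional ℂ E]
  {EM : Type*} [NormedAddCommGroup EM] [NormedSpace ℂ EM]
  {M : Type*} [TopologicalSpace M] [ChartedSpace EM M]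
  {ι : Type*}

/-- **(L1) KERNEL LATTICE.**  For a relative exponential flow datum `ex : B × E → M` over `p` on the open `U` (`C^ω`, over `p`, bijective
differential, translation law, onto fibres) and `b ∈ U` with COMPACT fibre `p⁻¹ b`, the stabiliser `{w | ex (b, w) = ex (b, 0)}` is a full
lattice: it is `Φ₀ (ℤ^ι)` for some real frame `Φ₀ : (ι → ℝ) ≃L[ℝ] E`, whenever `card ι = 2 · dim_ℂ E`.  (Subgroup by the translation law;
discrete since `ex` is a local homeomorphism at `(b, 0)`; cocompact since `ex (b, ·)` is an open surjection onto the compact fibre.)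
[cite: BirkenhakeLange2004, §1.1 Lemma 1.1.2–1.1.3] [cite: MumfordAV1970, §1 (1)–(2)] -/
theorem exists_frame_kernel_of_relExpFlow [Fintype ι] [IsManifold 𝓘(ℂ, EB) ω B] [IsManifold 𝓘(ℂ, EM) ω M]
    {p : M → B} {U : Set B} {ex : B × E → M} (hU : IsOpen U)
    (hex : ContMDiffOn (𝓘(ℂ, EB).prod 𝓘(ℂ, E)) 𝓘(ℂ, EM) ω ex (U ×ˢ (univ : Set E)))
    (hp : ∀ b ∈ U, ∀ z : E, p (ex (b, z)) = b)
    (hbij : ∀ q ∈ U ×ˢ (univ : Set E), Bijective (mfderiv (𝓘(ℂ, EB).prod 𝓘(ℂ, E)) 𝓘(ℂ, EM) ex q))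
    (hsub : ∀ b ∈ U, ∀ z z' : E, ex (b, z) = ex (b, z') ↔ ex (b, z' - z) = ex (b, 0))
    (hsurj : ∀ m : M, p m ∈ U → ∃ z : E, ex (p m, z) = m)
    (hι : Fintype.card ι = 2 * Module.finrank ℂ E)
    {b : B} (hb : b ∈ U) (hcpt : IsCompact (p ⁻¹' {b})) :
    ∃ Φ₀ : (ι → ℝ) ≃L[ℝ] E, ∀ w : E, ex (b, w) = ex (b, 0) ↔ ∃ n : ι → ℤ, w = Φ₀ (fun i => (n i : ℝ)) := by
  -- the fibre map and its stabiliser subgroup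
  set ψ₀ : E → M := fun z ↦ ex (b, z) with hψ₀
  have hKsub : ∀ z z' : E, ψ₀ z = ψ₀ z' → z' - z ∈ {w : E | ex (b, w) = ex (b, 0)} := fun z z' h ↦
    (hsub b hb z z').1 h
  let K : AddSubgroup E := AddSubgroup.ofSub {w : E | ex (b, w) = ex (b, 0)} ⟨0, rfl⟩ (by
    intro x hx y hy
    rw [← sub_eq_add_neg]
    exact hKsub y x (hy.trans hx.symm))
  have hmemK : ∀ w : E, w ∈ K ↔ ex (b, w) = ex (b, 0) := fun w ↦ Iff.rfl
  -- the fibre as a compact space, and the fibre map onto it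
  haveI : CompactSpace (p ⁻¹' {b}) := isCompact_iff_compactSpace.1 hcpt
  let ψ : E → p ⁻¹' {b} := fun z ↦ ⟨ex (b, z), hp b hb z⟩
  have hψval : ∀ z, ((ψ z : p ⁻¹' {b}) : M) = ex (b, z) := fun z ↦ rfl
  have hcontψ₀ : Continuous ψ₀ :=
    hex.continuousOn.comp_continuous (continuous_const.prodMk continuous_id) fun z ↦ ⟨hb, mem_univ z⟩
  have hcont : Continuous ψ := hcontψ₀.subtype_mk _
  have hsurjψ : Surjective ψ := by
    rintro ⟨m, hm⟩
    have hpm : p m = b := hm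
    obtain ⟨z, hz⟩ := hsurj m (hpm ▸ hb)
    exact ⟨z, Subtype.ext (show ex (b, z) = m by rw [← hpm]; exact hz)⟩
  have hopen : IsOpenMap ψ := by
    intro W hW
    rw [isOpen_induced_iff]
    refine ⟨ex '' (U ×ˢ W), RelExpFlow.isOpen_image_prod hU hex hbij hW, ?_⟩
    ext ⟨m, hm⟩
    simp only [mem_preimage, mem_image]
    constructor
    · rintro ⟨⟨b', z⟩, ⟨hb', hz⟩, hq⟩
      have hpm : p m = b := hm
      have hbb' : b' = b := by rw [← hp b' hb' z, hq, hpm]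
      subst hbb'
      exact ⟨z, hz, Subtype.ext hq⟩
    · rintro ⟨z, hz, hzm⟩
      exact ⟨(b, z), ⟨hb, hz⟩, congrArg Subtype.val hzm⟩
  have hKψ : ∀ z z' : E, ψ z = ψ z' → z' - z ∈ K := fun z z' h ↦
    (hmemK _).2 (hKsub z z' (congrArg Subtype.val h))
  -- cocompact ⇒ the stabiliser spans `E` over `ℝ`
  have hspan : span ℝ (K : Set E) = ⊤ := RelExpFlow.span_eq_top_of_isOpenMap K ψ hcont hopen hsurjψ hKψ
  -- local injectivity at `(b, 0)` ⇒ the stabiliser is discrete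
  let L : Submodule ℤ E := AddSubgroup.toIntSubmodule K
  have hmemL : ∀ w : E, w ∈ L ↔ ex (b, w) = ex (b, 0) := fun w ↦ hmemK w
  haveI : DiscreteTopology L := by
    obtain ⟨V, hV, hinjV⟩ := RelExpFlow.exists_nhds_injOn hU hex hbij hb (0 : E)
    refine discreteTopology_of_isOpen_singleton_zero ?_
    obtain ⟨V', hV'V, hV'o, hV'0⟩ := mem_nhds_iff.1 hV
    rw [isOpen_induced_iff]
    refine ⟨V', hV'o, ?_⟩
    ext ⟨x, hx⟩
    simp only [mem_preimage, mem_singleton_iff, Subtype.ext_iff, ZeroMemClass.coe_zero]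
    constructor
    · intro hxV'
      exact hinjV (hV'V hxV') (hV'V hV'0) ((hmemL x).1 hx)
    · rintro rfl
      exact hV'0
  haveI : IsZLattice ℝ L := ⟨hspan⟩
  -- a `ℤ`-basis of the lattice on the index type `ι` is the frame
  obtain ⟨Φ₀, hΦ₀⟩ := RelExpFlow.exists_frame_of_isZLattice (ι := ι) L hι
  exact ⟨Φ₀, fun w ↦ (hmemL w).symm.trans (hΦ₀ w)⟩

end KernelLattice

end Literature.Geometry.ComplexAnalytic

end
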